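import Summits.HubbardSuperconductivity.HubbardSuperconductivity.Theses.FunctionFieldCertificate
import Summits.HubbardSuperconductivity.HubbardSuperconductivity.Theorems.FunctionFieldCertificateMesoscopicPairOrderStubBoxExpectation
import Summits.HubbardSuperconductivity.HubbardSuperconductivity.Theorems.FunctionFieldCertificateMesoscopicPairOrderStubChordFloor
import HarnessLib

/-!
# Crux `MesoscopicPairOrder` (stmt-HubbardSuperconductivity-7331), line `Sketch` — chord-floor half:
# the lead's skeleton

Route `FunctionFieldCertificate`, crux 2 (pole-free half): at one `(U, δ)`, a margin `m R²` for the
Fejér-box average `T_R(ψ)/L² = L⁻² Σ_{x,y} Πᵢ (1 - |(y - x)ᵢ|_L/R)₊ Re⟨P_x ψ, P_y ψ⟩` of the `d`-wave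
pair correlation at arbitrarily large block scales `R`, in EVERY normalised `(N_L, S^z = 0)`-sector
ground state of all large even tori (`P_x = localPair dWaveFormFactor L x`,
`H_L = hubbardTorus 2 L 1 U`, `N_L = 2⌊(1-δ)L²/2⌋`).

The line (card `Cruxes/MesoscopicPairOrder/Ideas/chord-floor-two-energies.md`): penalise `H_L` by the
crux's own order operator, the BOX PAIR REPULSION
`K_R := Σ_{x,y} W_R(y - x) P_xᴴ P_y`, `W_R(z) = Πᵢ (1 - |zᵢ|_L/R)₊` (Hermitian, `≥ 0`, finite range,
translation and `U(1) × SU(2)` invariant, sector preserving), with a POSITIVE coupling `ε`. For every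
normalised sector ground state `ψ` of `H_L` the chord of the concave sector energy lies below the
tangent: `E_K(H_L + εK_R) - E_K(H_L) ≤ ε Re⟨ψ, K_R ψ⟩ = ε T_R(ψ)` (`K = szSector N_L 0`; `ψ` is a trial
state for the penalised problem). Hence the crux — whose whole difficulty is a lower bound holding
for EVERY ground state — follows from a statement that mentions no state at all, the CHORD GAP
`ε · m · R² · L² ≤ E_K(H_L + εK_R) - E_K(H_L)`.

Stubs (registered on the crux item by `ledger skeleton check`):
* `stub_boxExpectation` (S) — `Re⟨ψ, K_R ψ⟩ = T_R(ψ)` (bookkeeping) — LANDED p96295, imported;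
* `stub_chordFloor` (S) — the chord inequality for a normalised sector ground state of `H_L` and ANY
  perturbation `Y` (one variational line; the tree's `Theorems.chord_div_le_re_expect_of_eigen`) —
  LANDED p96247, imported;
* `stub_chordGap` (LOAD-BEARING, open) — the chord gap at one `(U, δ)`, arbitrarily large `R`, all
  large even `L`, with `ε > 0` allowed to depend on `L` (the weakest form that still gives the crux; by
  finite-dimensional Danskin it is EQUIVALENT to the crux, see the lead's support file
  `Theorems/FunctionFieldCertificateMesoscopicPairOrderChord.lean`).

Composition `MesoscopicPairOrder_of : MesoscopicPairOrder` below. No definition is introduced (the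
operator `K_R` is written inline). Tasaki (2020) §2.1 (variational principle); Griffiths, J. Math.
Phys. 5 (1964) 1215 (chords of concave ground energies); folklore.
-/

noncomputable section

-- the summit namespace `Summit.HubbardSuperconductivity.HubbardSuperconductivity.…` repeats the problem name by design (D-0017)
set_option linter.dupNamespace false

namespace Summit.HubbardSuperconductivity.HubbardSuperconductivity.Theorems.FunctionFieldCertificate

open Matrix Finset Filter
open Literature.Probability.LatticeModels Literature.MathematicalPhysics.QuantumLattice
open Summit.HubbardSuperconductivity.HubbardSuperconductivity.Theses.FunctionFieldCertificate
open scoped ComplexOrder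

/-! ### Stubs 1 and 2 — LANDED

* `stub_boxExpectation` (`Re⟨ψ, K_R ψ⟩ = T_R(ψ)`): p96295,
  `Theorems/FunctionFieldCertificateMesoscopicPairOrderStubBoxExpectation.lean` (imported);
* `stub_chordFloor` (`E_K(H + εY) - E_K(H) ≤ ε Re⟨ψ, Y ψ⟩` for a normalised sector ground state `ψ`
  of `H`): p96247, `Theorems/FunctionFieldCertificateMesoscopicPairOrderStubChordFloor.lean`
  (imported). -/

/-! ### Stub 3 — the chord gap (load-bearing) -/

/-- **Stub `stub_chordGap`** (LOAD-BEARING; the open content of the line). At some `U > 0`,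
`δ ∈ (0, 1/2)` there is `m > 0` such that for arbitrarily large scales `R` and all large even `L` the
sector ground energy of the box-pair-REPELLED model exceeds that of the pure model by an extensive
amount for some coupling `ε > 0` (allowed to depend on `L`):
`ε · m · R² · L² ≤ E_K(H_L + ε K_R) - E_K(H_L)`, `K = szSector N_L 0`, `N_L = 2⌊(1-δ)L²/2⌋`,
`K_R = Σ_{x,y} W_R(y - x) • (P_xᴴ P_y)` inline. A statement about two numbers per `(R, L)`; by the
chord floor it implies the crux with the same `m`, and by finite-dimensional Danskin (lead's support
file) the crux implies it back, so it is the crux in stateless form. OPEN (it is the pole-free half of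
`d`-wave superconductivity in the pure 2D Hubbard model). -/
theorem stub_chordGap : ∃ U : ℝ, 0 < U ∧ ∃ δ ∈ Set.Ioo (0:ℝ) (1 / 2), ∃ m : ℝ, 0 < m ∧
    ∀ R₀ : ℕ, ∃ R : ℕ, R₀ ≤ R ∧ ∃ L₀ : ℕ, ∀ (L : ℕ) [NeZero L], L₀ ≤ L → Even L → ∃ ε : ℝ, 0 < ε ∧
      ε * (m * (R : ℝ) ^ 2 * (L : ℝ) ^ 2) ≤
        (hubbardTorus 2 L 1 U + (ε : ℂ) • (∑ x : TorusSite 2 L, ∑ y : TorusSite 2 L,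
            ((∏ i : Fin 2, max 0 (1 - |(((y i - x i).valMinAbs : ℤ) : ℝ)| / (R : ℝ)) : ℝ) : ℂ) •
              ((localPair dWaveFormFactor L x)ᴴ * localPair dWaveFormFactor L y))).minEnergyOn
            (szSector (2 * ⌊(1 - δ) * (L : ℝ) ^ 2 / 2⌋₊) 0) -
          (hubbardTorus 2 L 1 U).minEnergyOn (szSector (2 * ⌊(1 - δ) * (L : ℝ) ^ 2 / 2⌋₊) 0) := by
  sorry

/-! ### Registered sub-goals of lead c4 (support files, LANDED; NOT used by the composition)

* `interactionLoadBearing` — p120050 `Theorems/MesoscopicPairOrder/Negative/FlatStructureFactor.lean`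
  (`FunctionFieldCertificate.interactionLoadBearing`): the crux body with `U := 0` fails at every `δ ≥ -1`
  (free Fermi gas: a normalised sector ground state with flat pair structure factor `S_ψ ≤ 50`, hence
  `T_R(ψ)/L² ≤ 50`); with the kill criterion `Negative.pointwise_false_of_frequently_flat_groundState`.
* `mesoscopicPairOrderIffInfraredPairWeight`, `mesoscopicPairOrderAt_iff_infraredPairWeightAt` — p120205 (+ append)
  `Theorems/FunctionFieldCertificateMesoscopicPairOrderInfraredWeight.lean`: `R² T_R(ψ) = Σ_m |F_R(m)|² S_ψ(m)` and
  **`MesoscopicPairOrder ↔` uniform infrared pair-weight floor** (`∃ μ > 0 ∀ ε > 0`, all large even `L`, every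
  normalised sector GS: `μ L² ≤ Σ_{m : |q_m|² ≤ ε²} S_ψ(m)`), on `Literature/…/BlockPairPlancherel.lean` (p119425)
  and `Literature/Probability/LatticeModels/BoxKernelBounds.lean` (p120009). -/

/-! ### Composition -/

/-- **The line closes the crux modulo its stubs**: `stub_chordGap`, read through `stub_chordFloor`
at the trial state `ψ` and the bookkeeping `stub_boxExpectation`, gives
`ε m R² L² ≤ E_K(H_L + εK_R) - E_K(H_L) ≤ ε Re⟨ψ, K_R ψ⟩ = ε T_R(ψ)`, i.e. `m R² ≤ T_R(ψ)/L²` for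
every normalised sector ground state `ψ` — the body of `MesoscopicPairOrder` with the same
`(U, δ, m, R, L₀)`. [folklore] -/
theorem MesoscopicPairOrder_of : MesoscopicPairOrder := by
  obtain ⟨U, hU, δ, hδ, m, hm, hall⟩ := stub_chordGap
  refine ⟨U, hU, δ, hδ, m, hm, fun R₀ => ?_⟩
  obtain ⟨R, hR₀, L₀, hL⟩ := hall R₀
  refine ⟨R, hR₀, L₀, ?_⟩
  intro L _ hL₀ hE ψ hψ hgs
  obtain ⟨ε, hε, hgap⟩ := hL L hL₀ hE
  have hchord := stub_chordFloor L U ε (2 * ⌊(1 - δ) * (L : ℝ) ^ 2 / 2⌋₊)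
    (∑ x : TorusSite 2 L, ∑ y : TorusSite 2 L,
      ((∏ i : Fin 2, max 0 (1 - |(((y i - x i).valMinAbs : ℤ) : ℝ)| / (R : ℝ)) : ℝ) : ℂ) •
        ((localPair dWaveFormFactor L x)ᴴ * localPair dWaveFormFactor L y)) ψ hε hψ hgs
  rw [stub_boxExpectation L R ψ] at hchord
  have hLpos : (0 : ℝ) < L := Nat.cast_pos.2 (Nat.pos_of_ne_zero (NeZero.ne L))
  have hL2 : (0 : ℝ) < (L : ℝ) ^ 2 := by positivity
  rw [le_div_iff₀ hL2]
  have key : ε * (m * (R : ℝ) ^ 2 * (L : ℝ) ^ 2) ≤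
      ε * ∑ x : TorusSite 2 L, ∑ y : TorusSite 2 L,
        (∏ i : Fin 2, max 0 (1 - |(((y i - x i).valMinAbs : ℤ) : ℝ)| / (R : ℝ))) *
          (star (localPair dWaveFormFactor L x *ᵥ ψ) ⬝ᵥ (localPair dWaveFormFactor L y *ᵥ ψ)).re :=
    hgap.trans hchord
  have := le_of_mul_le_mul_left key hε
  linarith

end Summit.HubbardSuperconductivity.HubbardSuperconductivity.Theorems.FunctionFieldCertificate
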